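import Summits.HodgeConjecture.HodgeConjecture.Theorems.Q8BireflectionRecognitionHomological
import Summits.HodgeConjecture.HodgeConjecture.Theorems.Q8SymplecticPowersMonodromyDeckCommutes
import Literature.AlgebraicGeometry.HodgeTheory.FibrewiseDeckRelations
import Literature.AlgebraicGeometry.HodgeTheory.BettiUniverseTracePairing
import Literature.AlgebraicGeometry.HodgeTheory.ComplexOrientationIsomorphism
import HarnessLib

/-!
# K1Q stub S5 (`stub_monodromyBireflectionQ`, skeleton v6) ASSEMBLED on the family carrier, modulo the geometric two-ball datum

Sub-problem `HodgeConjecture`, route `Summits/HodgeConjecture/HodgeConjecture/Theses/Q8SymplecticPowers.lean` (crux K1Q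
`VeryGeneralQuaternionCommutatorsInHg`, stmt-HodgeConjecture-24190, skeleton v6 stub S5). Written by the prover seat
`hodge-nonav-prover-Ax` (g18). HC ∕ HC_AV ∕ K1Q are NOT proved here.

`monodromyBireflection_of_twoBallDatum`: for a smooth projective family of surfaces `π : 𝒳 ⟶ S` (quasi-projective total space and
base, cohomologically locally trivial) with a deck pair `τ j : 𝒳 ⟶ 𝒳` over `S` (`τ⁴ = 𝟙`, `j² = τ²`, `τjτ = j`) and a point `s`, the
∃-clause of S5-v6 AT `s` — literally in the stub's currency `A := pull (fiberOverEnd π τ hτπ s) 2`, `B`, `Qf := tr ∘ cup`,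
`Γ := ratMonodromyGroup π 2 hU ⟨s, _⟩`, eigenspaces base-changed to `ℂ`, `Complex.I` — follows from the GEOMETRIC INPUTS at `s`:
a monodromy transformation `γ ∈ Γ` realised by a homeomorphism `h` of `X_s(ℂ)` fixing the fundamental class, Poincaré duality
bijective for the rational complex orientation, and the homological two-ball datum `W₁, W₂ ≤ H₂(X_s(ℂ); ℚ)` of the localisation
(`Literature…HomologySelfMapTwoLocalPieces`, `Literature…PhamBrieskornA3QuotientPieceHomology.localPiece_package_of_conj`) with the
disjoint-carrier orthogonality. Everything cohomological is DERIVED here from the tree: symmetry and non-degeneracy of the trace form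
(graded commutativity; `BettiUniverse.nondegenerate_tr_cup`), the quaternion relations of `τ_s^*, j_s^*`
(`BettiUniverse.quaternionRelations_pull_fiberOverEnd`), the deck isometries (`BettiUniverse.tr_cup_pull_pull_of_comp_eq_id`), monodromy
commuting with `τ_s^*` and preserving the trace form (`Q8SymplecticPowersMonodromyDeckCommutes`), the deck duality squares
(`ComplexOrientationIsomorphism`), and the recognition `Q8BireflectionRecognitionHomological.exists_bireflection_datum_of_homological_datum_poincare`.

What remains for S5-v6 after this file: the geometric monodromy `h` of a d6 meridian with its two-ball datum (bricks L6-2, L6-4 of memo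
`LOC6-ARCHITECTURE-Ax-g18.md`) and the discharge of `hPD` (`bijective_poincareDualityMap`).
-/

noncomputable section

set_option backward.isDefEq.respectTransparency false
set_option linter.dupNamespace false

open Module LinearMap CategoryTheory
open scoped TensorProduct
open Literature.AlgebraicTopology.SingularHomology Literature.AlgebraicGeometry Literature.AlgebraicGeometry.Motives
open Literature.AlgebraicGeometry.HodgeTheory Literature.AlgebraicGeometry.HodgeTheory.BettiUniverse

namespace Summit.HodgeConjecture.HodgeConjecture.Theorems.Q8MonodromyBireflectionAssembly

open Summit.HodgeConjecture.HodgeConjecture.Theorems.Q8BireflectionRecognitionHomological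
open Summit.HodgeConjecture.HodgeConjecture.Theorems.Q8SymplecticPowersMonodromyDeckCommutes

variable {𝒳 S : SchemeOver ℂ} (π : 𝒳 ⟶ S) {τ : 𝒳 ⟶ 𝒳} (hτπ : τ ≫ π = π)

/-- `(τ³)_s`, the fibre endomorphism of `τ ≫ τ ≫ τ`. [folklore] -/
private theorem comp3_π (hτπ : τ ≫ π = π) : (τ ≫ τ ≫ τ) ≫ π = π := by
  rw [Category.assoc, Category.assoc, hτπ, hτπ, hτπ]

/-- `τ_s ≫ (τ³)_s = 𝟙` when `τ⁴ = 𝟙`. [cite: Fulton1998, §10.1] -/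
theorem fiberOverEnd_comp_cube_eq_id (h4 : τ ≫ τ ≫ τ ≫ τ = 𝟙 𝒳) (s : AlgPoints S ℂ) :
    fiberOverEnd π τ hτπ s ≫ fiberOverEnd π (τ ≫ τ ≫ τ) (comp3_π π hτπ) s = 𝟙 (fiberOver π s) := by
  rw [← fiberOverEnd_comp π τ (τ ≫ τ ≫ τ) hτπ (comp3_π π hτπ) s, ← fiberOverEnd_id π s]
  exact fiberOverEnd_congr π h4 _ _ s

/-- `(τ³)_s ≫ τ_s = 𝟙` when `τ⁴ = 𝟙`. [cite: Fulton1998, §10.1] -/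
theorem fiberOverEnd_cube_comp_eq_id (h4 : τ ≫ τ ≫ τ ≫ τ = 𝟙 𝒳) (s : AlgPoints S ℂ) :
    fiberOverEnd π (τ ≫ τ ≫ τ) (comp3_π π hτπ) s ≫ fiberOverEnd π τ hτπ s = 𝟙 (fiberOver π s) := by
  have h4' : (τ ≫ τ ≫ τ) ≫ τ = 𝟙 𝒳 := by simpa only [Category.assoc] using h4
  rw [← fiberOverEnd_comp π (τ ≫ τ ≫ τ) τ (comp3_π π hτπ) hτπ s, ← fiberOverEnd_id π s]
  exact fiberOverEnd_congr π h4' _ _ s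

/-- `j⁴ = 𝟙` from `j² = τ²`, `τ⁴ = 𝟙`. [folklore] -/
theorem comp_four_eq_id_of_sq {j : 𝒳 ⟶ 𝒳} (h4 : τ ≫ τ ≫ τ ≫ τ = 𝟙 𝒳) (hjj : j ≫ j = τ ≫ τ) : j ≫ j ≫ j ≫ j = 𝟙 𝒳 := by
  have : j ≫ j ≫ j ≫ j = (j ≫ j) ≫ (j ≫ j) := by simp only [Category.assoc]
  rw [this, hjj, Category.assoc, h4]


/-! ### The assembly -/

/-- **K1Q stub S5 (v6) at a point `s`, from the geometric two-ball datum.** For a smooth projective family of surfaces `π : 𝒳 ⟶ S`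
(quasi-projective, cohomologically locally trivial) with a deck pair `τ j` over `S` (`τ⁴ = 𝟙`, `j² = τ²`, `τjτ = j`): if a monodromy
transformation `γ ∈ Γ_s` is realised by a homeomorphism `h` of `X_s(ℂ)` fixing the fundamental class, Poincaré duality is bijective
for the rational complex orientation, and `W₁, W₂ ≤ H₂(X_s(ℂ); ℚ)` is a homological two-ball datum for `(τ_s(ℂ)_*, j_s(ℂ)_*, h_*)` whose
Poincaré-dual carriers are `Qf`-orthogonal, then the ∃-clause of `stub_monodromyBireflectionQ` (skeleton v6) holds at `s`, with this `γ`.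
[cite: VoisinHodgeII2003, §3.1.2 and §3.2.1] [cite: HatcherAT2002, §3.3 Thm. 3.30 and Prop. 3.38] -/
theorem monodromyBireflection_of_twoBallDatum (hπ : IsSmoothProjectiveFamily π 2) (h𝒳 : IsQuasiProjectiveOver 𝒳)
    (hS : IsQuasiProjectiveOver S) {j : 𝒳 ⟶ 𝒳} (hjπ : j ≫ π = π) (h4 : τ ≫ τ ≫ τ ≫ τ = 𝟙 𝒳) (hjj : j ≫ j = τ ≫ τ)
    (hτjτ : τ ≫ j ≫ τ = j) (hU : IsCohomologicallyLocallyTrivialOn π (Set.univ : Set (ComplexPoints S))) (s : ComplexPoints S)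
    (γ : bettiCohomology (fiberOver π s) 2 ≃ₗ[ℚ] bettiCohomology (fiberOver π s) 2)
    (hγΓ : γ ∈ ratMonodromyGroup π 2 hU ⟨s, Set.mem_univ s⟩)
    (h : ComplexPoints (fiberOver π s) ≃ₜ ComplexPoints (fiberOver π s))
    (hγh : ∀ a, γ a = (singularCohomology.map ℚ ℚ (h : C(ComplexPoints (fiberOver π s), ComplexPoints (fiberOver π s))) 2).hom a)
    (hhμ : singularHomology.map ℚ ℚ (h : C(ComplexPoints (fiberOver π s), ComplexPoints (fiberOver π s))) 4
      (complexOrientationRat (hπ.isSmoothProjective s)).fundamentalClass = (complexOrientationRat (hπ.isSmoothProjective s)).fundamentalClass)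
    (hPD : Function.Bijective (poincareDualityMap (n := 4) (complexOrientationRat (hπ.isSmoothProjective s)) (show 2 + 2 = 4 by norm_num)))
    (W₁ W₂ : Submodule ℚ (singularHomology ℚ ℚ (ComplexPoints (fiberOver π s)) 2)) (hW₁ : finrank ℚ W₁ = 2) (hW₂ : finrank ℚ W₂ = 2)
    (htW₁ : ∀ w ∈ W₁, singularHomology.map ℚ ℚ (AlgPoints.mapContinuous (L := ℂ) (fiberOverEnd π τ hτπ s)) 2 w ∈ W₁)
    (htW₂ : ∀ w ∈ W₂, singularHomology.map ℚ ℚ (AlgPoints.mapContinuous (L := ℂ) (fiberOverEnd π τ hτπ s)) 2 w ∈ W₂)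
    (htt₁ : ∀ w ∈ W₁, singularHomology.map ℚ ℚ (AlgPoints.mapContinuous (L := ℂ) (fiberOverEnd π τ hτπ s)) 2
      (singularHomology.map ℚ ℚ (AlgPoints.mapContinuous (L := ℂ) (fiberOverEnd π τ hτπ s)) 2 w) = -w)
    (htt₂ : ∀ w ∈ W₂, singularHomology.map ℚ ℚ (AlgPoints.mapContinuous (L := ℂ) (fiberOverEnd π τ hτπ s)) 2
      (singularHomology.map ℚ ℚ (AlgPoints.mapContinuous (L := ℂ) (fiberOverEnd π τ hτπ s)) 2 w) = -w)
    (hjW₁ : ∀ w ∈ W₁, singularHomology.map ℚ ℚ (AlgPoints.mapContinuous (L := ℂ) (fiberOverEnd π j hjπ s)) 2 w ∈ W₂)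
    (hjW₂ : ∀ w ∈ W₂, singularHomology.map ℚ ℚ (AlgPoints.mapContinuous (L := ℂ) (fiberOverEnd π j hjπ s)) 2 w ∈ W₁)
    (hvar : ∀ y, singularHomology.map ℚ ℚ (AlgPoints.mapContinuous (L := ℂ) (fiberOverEnd π τ hτπ s)) 2
      (singularHomology.map ℚ ℚ (AlgPoints.mapContinuous (L := ℂ) (fiberOverEnd π τ hτπ s)) 2 y) = -y →
      singularHomology.map ℚ ℚ (h : C(ComplexPoints (fiberOver π s), ComplexPoints (fiberOver π s))) 2 y - y ∈ W₁ ⊔ W₂)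
    (hh₁ : ∀ w ∈ W₁, singularHomology.map ℚ ℚ (h : C(ComplexPoints (fiberOver π s), ComplexPoints (fiberOver π s))) 2 w =
      singularHomology.map ℚ ℚ (AlgPoints.mapContinuous (L := ℂ) (fiberOverEnd π τ hτπ s)) 2 w)
    (hh₂ : ∀ w ∈ W₂, singularHomology.map ℚ ℚ (h : C(ComplexPoints (fiberOver π s), ComplexPoints (fiberOver π s))) 2
      (singularHomology.map ℚ ℚ (AlgPoints.mapContinuous (L := ℂ) (fiberOverEnd π τ hτπ s)) 2 w) = w)
    (horth : ∀ a b, poincareDualityMap (n := 4) (complexOrientationRat (hπ.isSmoothProjective s)) (show 2 + 2 = 4 by norm_num) a ∈ W₁ →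
      poincareDualityMap (n := 4) (complexOrientationRat (hπ.isSmoothProjective s)) (show 2 + 2 = 4 by norm_num) b ∈ W₂ →
      tr (hπ.isSmoothProjective s) (2 + 2) (cup (fiberOver π s) 2 2 a b) = 0) :
    let Xs := fiberOver π s
    let hXs : IsSmoothProjective 2 Xs := hπ.isSmoothProjective s
    let A : bettiCohomology Xs 2 →ₗ[ℚ] bettiCohomology Xs 2 := pull (fiberOverEnd π τ hτπ s) 2
    let B : bettiCohomology Xs 2 →ₗ[ℚ] bettiCohomology Xs 2 := pull (fiberOverEnd π j hjπ s) 2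
    let Qf : LinearMap.BilinForm ℚ (bettiCohomology Xs 2) := LinearMap.compr₂ (cup Xs 2 2) (tr hXs (2 + 2))
    let Γ := ratMonodromyGroup π 2 hU ⟨s, Set.mem_univ s⟩
    ∃ γ ∈ Γ, ∃ ℓp ℓm : TensorProduct ℚ ℂ (bettiCohomology Xs 2),
      ℓp ∈ (Module.End.eigenspace (A ^ 2) (-1)).baseChange ℂ ∧ ℓm ∈ (Module.End.eigenspace (A ^ 2) (-1)).baseChange ℂ ∧
      A.baseChange ℂ ℓp = Complex.I • ℓp ∧ A.baseChange ℂ ℓm = Complex.I • ℓm ∧ (Qf.baseChange ℂ) ℓp (B.baseChange ℂ ℓm) ≠ 0 ∧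
      (γ.toLinearMap.baseChange ℂ) ℓp = Complex.I • ℓp ∧ (γ.toLinearMap.baseChange ℂ) ℓm = (-Complex.I) • ℓm ∧
      ∀ x ∈ (Module.End.eigenspace (A ^ 2) (-1)).baseChange ℂ, A.baseChange ℂ x = Complex.I • x →
        (Qf.baseChange ℂ) x (B.baseChange ℂ ℓp) = 0 → (Qf.baseChange ℂ) x (B.baseChange ℂ ℓm) = 0 → (γ.toLinearMap.baseChange ℂ) x = x := by
  intro Xs hXs A B Qf Γ
  -- finiteness
  haveI : Module.Finite ℚ (bettiCohomology Xs 2) := BettiUniverse.finite hXs 2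
  haveI : Module.Finite ℚ (singularHomology ℚ ℚ (ComplexPoints Xs) 2) :=
    Module.Finite.of_surjective (poincareDualityMap (n := 4) (complexOrientationRat hXs) (show 2 + 2 = 4 by norm_num)) hPD.2
  -- the deck automorphisms of the fibre as isomorphisms / homeomorphisms
  let eτ : Xs ≅ Xs := ⟨fiberOverEnd π τ hτπ s, fiberOverEnd π (τ ≫ τ ≫ τ) (comp3_π π hτπ) s,
    fiberOverEnd_comp_cube_eq_id π hτπ h4 s, fiberOverEnd_cube_comp_eq_id π hτπ h4 s⟩
  let ej : Xs ≅ Xs := ⟨fiberOverEnd π j hjπ s, fiberOverEnd π (j ≫ j ≫ j) (comp3_π π hjπ) s,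
    fiberOverEnd_comp_cube_eq_id π hjπ (comp_four_eq_id_of_sq h4 hjj) s,
    fiberOverEnd_cube_comp_eq_id π hjπ (comp_four_eq_id_of_sq h4 hjj) s⟩
  let τh : ComplexPoints Xs ≃ₜ ComplexPoints Xs := HodgeTheory.AlgPoints.homeomorphOfIso eτ
  let jh : ComplexPoints Xs ≃ₜ ComplexPoints Xs := HodgeTheory.AlgPoints.homeomorphOfIso ej
  have hτA : (singularCohomology.map ℚ ℚ (τh : C(ComplexPoints Xs, ComplexPoints Xs)) 2).hom = A := rfl
  have hjB : (singularCohomology.map ℚ ℚ (jh : C(ComplexPoints Xs, ComplexPoints Xs)) 2).hom = B := rfl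
  have hτH : singularHomology.map ℚ ℚ (τh : C(ComplexPoints Xs, ComplexPoints Xs)) 2 =
      singularHomology.map ℚ ℚ (AlgPoints.mapContinuous (L := ℂ) (fiberOverEnd π τ hτπ s)) 2 := rfl
  have hjH : singularHomology.map ℚ ℚ (jh : C(ComplexPoints Xs, ComplexPoints Xs)) 2 =
      singularHomology.map ℚ ℚ (AlgPoints.mapContinuous (L := ℂ) (fiberOverEnd π j hjπ s)) 2 := rfl
  -- the cohomological quaternion relations
  obtain ⟨hA4', hBB', hBA'⟩ := quaternionRelations_pull_fiberOverEnd π hτπ hjπ h4 hjj hτjτ s 2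
  have hA4' : A ^ 4 = 1 := hA4'
  have hBB' : B ^ 2 = A ^ 2 := hBB'
  have hBA' : B * A = A ^ 3 * B := hBA'
  have hA4 : ∀ x, A (A (A (A x))) = x := fun x => by
    have := LinearMap.congr_fun hA4' x
    simpa only [pow_succ, pow_zero, one_mul, Module.End.mul_apply, Module.End.one_apply] using this
  have hBB : ∀ x, B (B x) = A (A x) := fun x => by
    have := LinearMap.congr_fun hBB' x
    simpa only [pow_two, Module.End.mul_apply] using this
  have hABA' : A * B * A = B := by
    rw [mul_assoc, hBA', ← mul_assoc, ← pow_succ', hA4', one_mul]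
  have hABA : ∀ x, A (B (A x)) = B x := fun x => by
    have := LinearMap.congr_fun hABA' x
    simpa only [Module.End.mul_apply] using this
  have hBA2 : B * A ^ 2 = A ^ 2 * B := by
    have h6 : A ^ 3 * A ^ 3 = A ^ 2 := by
      rw [← pow_add, show 3 + 3 = 4 + 2 by norm_num, pow_add, hA4', one_mul]
    calc B * A ^ 2 = (B * A) * A := by rw [pow_two, mul_assoc]
      _ = (A ^ 3 * B) * A := by rw [hBA']
      _ = A ^ 3 * (B * A) := by rw [mul_assoc]
      _ = A ^ 3 * (A ^ 3 * B) := by rw [hBA']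
      _ = (A ^ 3 * A ^ 3) * B := by rw [mul_assoc]
      _ = A ^ 2 * B := by rw [h6]
  have hBA : ∀ x, B (A (A x)) = A (A (B x)) := fun x => by
    have := LinearMap.congr_fun hBA2 x
    simpa only [pow_two, Module.End.mul_apply] using this
  -- the trace form
  have hQ : ∀ x y, Qf x y = tr hXs (2 + 2) (cup Xs 2 2 x y) := fun x y => rfl
  have hQs : ∀ x y, Qf x y = Qf y x := fun x y => by
    have hc := bettiCup_gradedComm (cupProduct_gradedComm_holds ℚ (ComplexPoints Xs)) (rfl : 2 + 2 = 2 + 2) rfl x y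
    have h1 : ((-1 : ℚ) ^ (2 * 2)) = 1 := by norm_num
    rw [h1, one_smul] at hc
    rw [hQ, hQ]
    exact congrArg _ hc
  have hQn : Qf.Nondegenerate := nondegenerate_tr_cup hXs
  have haQ : ∀ x y, Qf (A x) (A y) = Qf x y := fun x y =>
    tr_cup_pull_pull_of_comp_eq_id hXs (fiberOverEnd_comp_cube_eq_id π hτπ h4 s) (fiberOverEnd_cube_comp_eq_id π hτπ h4 s) 2 2 x y
  have hQb : ∀ x y, Qf (B x) (B y) = Qf x y := fun x y =>
    tr_cup_pull_pull_of_comp_eq_id hXs (fiberOverEnd_comp_cube_eq_id π hjπ (comp_four_eq_id_of_sq h4 hjj) s)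
      (fiberOverEnd_cube_comp_eq_id π hjπ (comp_four_eq_id_of_sq h4 hjj) s) 2 2 x y
  -- the monodromy transformation
  have hγA : ∀ x, γ (A x) = A (γ x) := fun x => apply_pull_fiberOverEnd_of_mem_ratMonodromyGroup π 2 hU τ hτπ s hγΓ x
  have hγQ : ∀ x y, Qf (γ x) (γ y) = Qf x y := fun x y => tr_cup_apply_apply_of_mem_ratMonodromyGroup π hπ h𝒳 hS hU s hγΓ x y
  have hγe : (singularCohomology.mapIso ℚ ℚ h 2).toLinearEquiv.toLinearMap = γ.toLinearMap :=
    LinearMap.ext fun a => (hγh a).symm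
  -- the deck duality squares
  have hτμ : singularHomology.map ℚ ℚ (τh : C(ComplexPoints Xs, ComplexPoints Xs)) 4 (complexOrientationRat hXs).fundamentalClass =
      (complexOrientationRat hXs).fundamentalClass := map_fundamentalClass_complexOrientationRat_of_iso hXs hXs eτ
  have hjμ : singularHomology.map ℚ ℚ (jh : C(ComplexPoints Xs, ComplexPoints Xs)) 4 (complexOrientationRat hXs).fundamentalClass =
      (complexOrientationRat hXs).fundamentalClass := map_fundamentalClass_complexOrientationRat_of_iso hXs hXs ej
  -- recognition
  have key := exists_bireflection_datum_of_homological_datum_poincare (X := ComplexPoints Xs) (L := ℂ)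
    (complexOrientationRat hXs) hPD (Q := Qf) hQs hQn τh jh h hτμ hjμ hhμ
    (by rw [hτA]; exact haQ) (by rw [hτA]; exact hA4) (by rw [hjB]; exact hQb) (by rw [hτA, hjB]; exact hBA)
    (by rw [hτA, hjB]; exact hBB) (by rw [hτA, hjB]; exact hABA)
    (fun x => by rw [hτA, ← hγh, ← hγh]; exact hγA x) (fun x y => by rw [← hγh, ← hγh]; exact hγQ x y)
    W₁ W₂ hW₁ hW₂ (by rw [hτH]; exact htW₁) (by rw [hτH]; exact htW₂) (by rw [hτH]; exact htt₁) (by rw [hτH]; exact htt₂)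
    (by rw [hjH]; exact hjW₁) (by rw [hjH]; exact hjW₂) (by rw [hτH]; exact hvar) (by rw [hτH]; exact hh₁) (by rw [hτH]; exact hh₂)
    horth (i := Complex.I) Complex.I_mul_I
  rw [hτA, hjB, hγe] at key
  exact ⟨γ, hγΓ, key⟩


/-! ### The rank hypotheses from `γ ≠ 1`

The two carriers `W₁, W₂` have rank AT MOST `2` by construction (`Literature…PhamBrieskornA3TwoBallDatum`: images of the rank-`2`
local pieces); rank EXACTLY `2` follows from `γ ≠ 1` alone: `τ_*² = −1` on `W_k` forces `dim W_k` even, `j_*` (injective) exchanges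
`W₁, W₂` so the ranks agree, and `γ ≠ 1 ⇒ h_* ≠ 1 ⇒` some variation `h_* y − y ∈ W₁ + W₂` is non-zero. -/

section Rank

variable {V : Type} [AddCommGroup V] [Module ℚ V]

/-- A `ℚ`-subspace carrying an endomorphism of square `−1` has even dimension (`det(t|_W)² = (−1)^{dim W}`). [folklore] -/
theorem even_finrank_of_sq_eq_neg_one [FiniteDimensional ℚ V] (W : Submodule ℚ V) (t : V →ₗ[ℚ] V) (htW : ∀ w ∈ W, t w ∈ W)
    (htt : ∀ w ∈ W, t (t w) = -w) : Even (finrank ℚ W) := by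
  let f : W →ₗ[ℚ] W := t.restrict htW
  have hff : f * f = (-1 : ℚ) • (LinearMap.id : ↥W →ₗ[ℚ] ↥W) := LinearMap.ext fun w => Subtype.ext (by
    show (t (t w) : V) = (((-1 : ℚ) • (w : ↥W) : ↥W) : V)
    rw [neg_one_smul]
    exact htt w w.2)
  have hdet : LinearMap.det f * LinearMap.det f = (-1) ^ finrank ℚ W := by
    rw [← LinearMap.det_comp, show f ∘ₗ f = f * f from rfl, hff, LinearMap.det_smul, LinearMap.det_id, mul_one]
  rcases Nat.even_or_odd (finrank ℚ W) with he | ho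
  · exact he
  · exfalso
    rw [ho.neg_one_pow] at hdet
    nlinarith [mul_self_nonneg (LinearMap.det f)]

/-- `dim W ≤ 2`, `dim W` even and `W ≠ 0` give `dim W = 2`. [folklore] -/
theorem finrank_eq_two_of_le_two [FiniteDimensional ℚ V] (W : Submodule ℚ V) (hle : finrank ℚ W ≤ 2) (heven : Even (finrank ℚ W))
    (hne : W ≠ ⊥) : finrank ℚ W = 2 := by
  have h0 : finrank ℚ W ≠ 0 := fun h => hne (Submodule.finrank_eq_zero.mp h)
  obtain ⟨r, hr⟩ := heven
  omega

/-- An injective endomorphism mapping `W₁` into `W₂` gives `dim W₁ ≤ dim W₂`. [folklore] -/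
theorem finrank_le_of_mapsTo_of_injective [FiniteDimensional ℚ V] (W₁ W₂ : Submodule ℚ V) (g : V →ₗ[ℚ] V)
    (hg : Function.Injective g) (hgW : ∀ w ∈ W₁, g w ∈ W₂) : finrank ℚ W₁ ≤ finrank ℚ W₂ := by
  have hle : W₁.map g ≤ W₂ := by
    rintro _ ⟨w, hw, rfl⟩; exact hgW w hw
  calc finrank ℚ W₁ = finrank ℚ (W₁.map g) := (LinearEquiv.finrank_eq (Submodule.equivMapOfInjective g hg W₁))
    _ ≤ finrank ℚ W₂ := Submodule.finrank_mono hle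

/-- **Both carriers have rank `2`** as soon as the variation endomorphism `hm` is not the identity: `dim W₁ ≤ 2`, `t² = −1` on `W₁`,
`js` injective exchanging `W₁, W₂`, `hm y − y ∈ W₁ + W₂` for all `y`, `hm ≠ 1`. [folklore] -/
theorem finrank_eq_two_of_variation [FiniteDimensional ℚ V] (W₁ W₂ : Submodule ℚ V) (t js hm : V →ₗ[ℚ] V)
    (hW₁ : finrank ℚ W₁ ≤ 2) (htW₁ : ∀ w ∈ W₁, t w ∈ W₁) (htt₁ : ∀ w ∈ W₁, t (t w) = -w) (hjs : Function.Injective js)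
    (hjW₁ : ∀ w ∈ W₁, js w ∈ W₂) (hjW₂ : ∀ w ∈ W₂, js w ∈ W₁) (hvar : ∀ y, hm y - y ∈ W₁ ⊔ W₂) (hne : hm ≠ 1) :
    finrank ℚ W₁ = 2 ∧ finrank ℚ W₂ = 2 := by
  have h12 : finrank ℚ W₁ = finrank ℚ W₂ :=
    le_antisymm (finrank_le_of_mapsTo_of_injective W₁ W₂ js hjs hjW₁) (finrank_le_of_mapsTo_of_injective W₂ W₁ js hjs hjW₂)
  -- some variation is non-zero
  have hsup : W₁ ⊔ W₂ ≠ ⊥ := by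
    intro hbot
    apply hne
    ext y
    have hy := hvar y
    rw [hbot, Submodule.mem_bot, sub_eq_zero] at hy
    exact hy
  have hW₁ne : W₁ ≠ ⊥ := by
    intro h1
    have h2 : W₂ = ⊥ := Submodule.finrank_eq_zero.mp (by rw [← h12, h1, finrank_bot])
    exact hsup (by rw [h1, h2, bot_sup_eq])
  have h1 : finrank ℚ W₁ = 2 := finrank_eq_two_of_le_two W₁ hW₁ (even_finrank_of_sq_eq_neg_one W₁ t htW₁ htt₁) hW₁ne
  exact ⟨h1, h12 ▸ h1⟩

end Rank

/-- **K1Q stub S5 (v6) at a point `s` — rank hypotheses replaced by `γ ≠ 1`.** Same as `monodromyBireflection_of_twoBallDatum`, with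
`dim W₁ ≤ 2` (automatic for the image of a rank-`2` local piece), the unrestricted variation inclusion `h_* y − y ∈ W₁ + W₂`, and
`γ ≠ 1` in place of `dim W₁ = dim W₂ = 2`.
[cite: VoisinHodgeII2003, §3.1.2 and §3.2.1] [cite: HatcherAT2002, §3.3 Thm. 3.30 and Prop. 3.38] -/
theorem monodromyBireflection_of_twoBallDatum_of_ne_one (hπ : IsSmoothProjectiveFamily π 2) (h𝒳 : IsQuasiProjectiveOver 𝒳)
    (hS : IsQuasiProjectiveOver S) {j : 𝒳 ⟶ 𝒳} (hjπ : j ≫ π = π) (h4 : τ ≫ τ ≫ τ ≫ τ = 𝟙 𝒳) (hjj : j ≫ j = τ ≫ τ)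
    (hτjτ : τ ≫ j ≫ τ = j) (hU : IsCohomologicallyLocallyTrivialOn π (Set.univ : Set (ComplexPoints S))) (s : ComplexPoints S)
    (γ : bettiCohomology (fiberOver π s) 2 ≃ₗ[ℚ] bettiCohomology (fiberOver π s) 2)
    (hγΓ : γ ∈ ratMonodromyGroup π 2 hU ⟨s, Set.mem_univ s⟩) (hγ1 : γ ≠ 1)
    (h : ComplexPoints (fiberOver π s) ≃ₜ ComplexPoints (fiberOver π s))
    (hγh : ∀ a, γ a = (singularCohomology.map ℚ ℚ (h : C(ComplexPoints (fiberOver π s), ComplexPoints (fiberOver π s))) 2).hom a)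
    (hhμ : singularHomology.map ℚ ℚ (h : C(ComplexPoints (fiberOver π s), ComplexPoints (fiberOver π s))) 4
      (complexOrientationRat (hπ.isSmoothProjective s)).fundamentalClass = (complexOrientationRat (hπ.isSmoothProjective s)).fundamentalClass)
    (hPD : Function.Bijective (poincareDualityMap (n := 4) (complexOrientationRat (hπ.isSmoothProjective s)) (show 2 + 2 = 4 by norm_num)))
    (W₁ W₂ : Submodule ℚ (singularHomology ℚ ℚ (ComplexPoints (fiberOver π s)) 2)) (hW₁ : finrank ℚ W₁ ≤ 2)
    (htW₁ : ∀ w ∈ W₁, singularHomology.map ℚ ℚ (AlgPoints.mapContinuous (L := ℂ) (fiberOverEnd π τ hτπ s)) 2 w ∈ W₁)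
    (htW₂ : ∀ w ∈ W₂, singularHomology.map ℚ ℚ (AlgPoints.mapContinuous (L := ℂ) (fiberOverEnd π τ hτπ s)) 2 w ∈ W₂)
    (htt₁ : ∀ w ∈ W₁, singularHomology.map ℚ ℚ (AlgPoints.mapContinuous (L := ℂ) (fiberOverEnd π τ hτπ s)) 2
      (singularHomology.map ℚ ℚ (AlgPoints.mapContinuous (L := ℂ) (fiberOverEnd π τ hτπ s)) 2 w) = -w)
    (htt₂ : ∀ w ∈ W₂, singularHomology.map ℚ ℚ (AlgPoints.mapContinuous (L := ℂ) (fiberOverEnd π τ hτπ s)) 2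
      (singularHomology.map ℚ ℚ (AlgPoints.mapContinuous (L := ℂ) (fiberOverEnd π τ hτπ s)) 2 w) = -w)
    (hjW₁ : ∀ w ∈ W₁, singularHomology.map ℚ ℚ (AlgPoints.mapContinuous (L := ℂ) (fiberOverEnd π j hjπ s)) 2 w ∈ W₂)
    (hjW₂ : ∀ w ∈ W₂, singularHomology.map ℚ ℚ (AlgPoints.mapContinuous (L := ℂ) (fiberOverEnd π j hjπ s)) 2 w ∈ W₁)
    (hvar : ∀ y, singularHomology.map ℚ ℚ (AlgPoints.mapContinuous (L := ℂ) (fiberOverEnd π τ hτπ s)) 2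
      (singularHomology.map ℚ ℚ (AlgPoints.mapContinuous (L := ℂ) (fiberOverEnd π τ hτπ s)) 2 y) = -y →
      singularHomology.map ℚ ℚ (h : C(ComplexPoints (fiberOver π s), ComplexPoints (fiberOver π s))) 2 y - y ∈ W₁ ⊔ W₂)
    (hvar' : ∀ y, singularHomology.map ℚ ℚ (h : C(ComplexPoints (fiberOver π s), ComplexPoints (fiberOver π s))) 2 y - y ∈ W₁ ⊔ W₂)
    (hh₁ : ∀ w ∈ W₁, singularHomology.map ℚ ℚ (h : C(ComplexPoints (fiberOver π s), ComplexPoints (fiberOver π s))) 2 w =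
      singularHomology.map ℚ ℚ (AlgPoints.mapContinuous (L := ℂ) (fiberOverEnd π τ hτπ s)) 2 w)
    (hh₂ : ∀ w ∈ W₂, singularHomology.map ℚ ℚ (h : C(ComplexPoints (fiberOver π s), ComplexPoints (fiberOver π s))) 2
      (singularHomology.map ℚ ℚ (AlgPoints.mapContinuous (L := ℂ) (fiberOverEnd π τ hτπ s)) 2 w) = w)
    (horth : ∀ a b, poincareDualityMap (n := 4) (complexOrientationRat (hπ.isSmoothProjective s)) (show 2 + 2 = 4 by norm_num) a ∈ W₁ →
      poincareDualityMap (n := 4) (complexOrientationRat (hπ.isSmoothProjective s)) (show 2 + 2 = 4 by norm_num) b ∈ W₂ →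
      tr (hπ.isSmoothProjective s) (2 + 2) (cup (fiberOver π s) 2 2 a b) = 0) :
    let Xs := fiberOver π s
    let hXs : IsSmoothProjective 2 Xs := hπ.isSmoothProjective s
    let A : bettiCohomology Xs 2 →ₗ[ℚ] bettiCohomology Xs 2 := pull (fiberOverEnd π τ hτπ s) 2
    let B : bettiCohomology Xs 2 →ₗ[ℚ] bettiCohomology Xs 2 := pull (fiberOverEnd π j hjπ s) 2
    let Qf : LinearMap.BilinForm ℚ (bettiCohomology Xs 2) := LinearMap.compr₂ (cup Xs 2 2) (tr hXs (2 + 2))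
    let Γ := ratMonodromyGroup π 2 hU ⟨s, Set.mem_univ s⟩
    ∃ γ ∈ Γ, ∃ ℓp ℓm : TensorProduct ℚ ℂ (bettiCohomology Xs 2),
      ℓp ∈ (Module.End.eigenspace (A ^ 2) (-1)).baseChange ℂ ∧ ℓm ∈ (Module.End.eigenspace (A ^ 2) (-1)).baseChange ℂ ∧
      A.baseChange ℂ ℓp = Complex.I • ℓp ∧ A.baseChange ℂ ℓm = Complex.I • ℓm ∧ (Qf.baseChange ℂ) ℓp (B.baseChange ℂ ℓm) ≠ 0 ∧
      (γ.toLinearMap.baseChange ℂ) ℓp = Complex.I • ℓp ∧ (γ.toLinearMap.baseChange ℂ) ℓm = (-Complex.I) • ℓm ∧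
      ∀ x ∈ (Module.End.eigenspace (A ^ 2) (-1)).baseChange ℂ, A.baseChange ℂ x = Complex.I • x →
        (Qf.baseChange ℂ) x (B.baseChange ℂ ℓp) = 0 → (Qf.baseChange ℂ) x (B.baseChange ℂ ℓm) = 0 → (γ.toLinearMap.baseChange ℂ) x = x := by
  intro Xs hXs A B Qf Γ
  haveI : Module.Finite ℚ (bettiCohomology Xs 2) := BettiUniverse.finite hXs 2
  haveI : Module.Finite ℚ (singularHomology ℚ ℚ (ComplexPoints Xs) 2) :=
    Module.Finite.of_surjective (poincareDualityMap (n := 4) (complexOrientationRat hXs) (show 2 + 2 = 4 by norm_num)) hPD.2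
  -- `j_s(ℂ)_*` is injective (induced by a homeomorphism)
  let ej : Xs ≅ Xs := ⟨fiberOverEnd π j hjπ s, fiberOverEnd π (j ≫ j ≫ j) (comp3_π π hjπ) s,
    fiberOverEnd_comp_cube_eq_id π hjπ (comp_four_eq_id_of_sq h4 hjj) s,
    fiberOverEnd_cube_comp_eq_id π hjπ (comp_four_eq_id_of_sq h4 hjj) s⟩
  let jh : ComplexPoints Xs ≃ₜ ComplexPoints Xs := HodgeTheory.AlgPoints.homeomorphOfIso ej
  have hjinj : Function.Injective (singularHomology.map ℚ ℚ (AlgPoints.mapContinuous (L := ℂ) (fiberOverEnd π j hjπ s)) 2).hom := by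
    change Function.Injective (singularHomology.mapIso ℚ ℚ jh 2).toLinearEquiv
    exact (singularHomology.mapIso ℚ ℚ jh 2).toLinearEquiv.injective
  -- `h_* ≠ 1` from `γ ≠ 1` through the duality square
  have hne : (singularHomology.map ℚ ℚ (h : C(ComplexPoints Xs, ComplexPoints Xs)) 2).hom ≠ 1 := by
    intro h1
    apply hγ1
    refine LinearEquiv.ext fun a => ?_
    have hsq := map_poincareDualityMap_map (complexOrientationRat hXs) (show 2 + 2 = 4 by norm_num)
      (h : C(ComplexPoints Xs, ComplexPoints Xs)) hhμ a
    have h1' : ∀ z, singularHomology.map ℚ ℚ (h : C(ComplexPoints Xs, ComplexPoints Xs)) 2 z = z := fun z =>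
      LinearMap.congr_fun h1 z
    rw [h1', ← hγh] at hsq
    exact hPD.1 hsq
  obtain ⟨hW₁', hW₂'⟩ := finrank_eq_two_of_variation W₁ W₂
    (singularHomology.map ℚ ℚ (AlgPoints.mapContinuous (L := ℂ) (fiberOverEnd π τ hτπ s)) 2).hom
    (singularHomology.map ℚ ℚ (AlgPoints.mapContinuous (L := ℂ) (fiberOverEnd π j hjπ s)) 2).hom
    (singularHomology.map ℚ ℚ (h : C(ComplexPoints Xs, ComplexPoints Xs)) 2).hom hW₁ htW₁ htt₁ hjinj hjW₁ hjW₂ hvar' hne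
  exact monodromyBireflection_of_twoBallDatum π hτπ hπ h𝒳 hS hjπ h4 hjj hτjτ hU s γ hγΓ h hγh hhμ hPD W₁ W₂ hW₁' hW₂' htW₁ htW₂
    htt₁ htt₂ hjW₁ hjW₂ hvar hh₁ hh₂ horth

end Summit.HodgeConjecture.HodgeConjecture.Theorems.Q8MonodromyBireflectionAssembly

end
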